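import Summits.ValiantsHypothesis.ValiantsHypothesis.Theorems.LacunarySymmetroidMatrixDescartesDoorA26WallBubblingMixedWalk
import Summits.ValiantsHypothesis.ValiantsHypothesis.Theorems.LacunarySymmetroidMatrixDescartesDoorA26WallBubblingMixedPairing
import Summits.ValiantsHypothesis.ValiantsHypothesis.Theorems.LacunarySymmetroidMatrixDescartesDoorA26WallBubblingNoBalance

/-!
# `DoorA26` / line `wall_bubbling` — MIXED ENDGAME: the short RESTRICTED kernel vector is impossible (rank-zero nodes allowed)

HONEST FRAMING.  Object-search cell `pub-symmetroid`, crux `Theses.LacunarySymmetroid.DoorA26` (stmt-ValiantsHypothesis-19979; OPEN, typed,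
never asserted).  W2 seat val-sym-door-p1 g19; def-free helper for obligation (R) of `Cruxes/DoorA26/Lines/wall_bubbling.lean`.  File #60 of
the MIXED chain #58–#63.  Imports #59 `…MixedWalk`, #58 `…MixedPairing`, #55 `…NoBalance`.

WHAT IS HERE.  ★ `false_of_short_restricted` — #55's `false_of_short_kernelVector` with a set `J₀ ⊆ J` of NODES where the pencil VANISHES: honest
encoding of `J`, `9 ≤ |J|`, `μ ≥ 0`, a test matrix `X` killing the pencil at two non-node touches `τ_l < τ_k`, and the vector
`a_j = μ_jκ_j polar(X,P(τ_j))`, supported on non-node touches before `τ_l`, non-zero, and RESTRICTED-orthogonal (`Σ_j a_j φ(τ_j) = 0` for every six-term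
`φ` vanishing at the node abscissae) ⇒ `False`.  Proof: cut `κ` along `J` by `≤ 2` flip midpoints (#54); cut the NODE-TWISTED values
`g(τ_j)·∏_i(τ_i − τ_j)` (`g = polar(X,P(·))`, vanishing at `τ_k, τ_l` and at every node) along the support at the abscissae right after each support element
(#59 `signCutAt`; these are never nodes); a twisted flip carries a non-node zero of `g` or a node with `g′ = 0` (#59 `exists_flipWitness`), so by
Descartes-with-double-zeros (#59) there are `≤ 3 − |J₀|` of them; the change points (κ-cuts Δ g̃-cuts) ∪ nodes are `≤ 5` and the sign-word function through
them vanishes at the nodes — #58 `eq_zero_of_pairing_signWord` kills `a`.  Nothing here bears on `DoorA26`, `DoorA34`, (W)/(M)/(R) as typed, `MatrixDescartes` (18050) or `VP ≠ VNP`; registers unchanged.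

[this work].
-/

set_option linter.dupNamespace false

namespace Summit.ValiantsHypothesis.ValiantsHypothesis.Theorems.LacunarySymmetroidMatrixDescartes.WallBubbling

open Finset Filter Topology
open Bubbling (polar polar_apply expSum hasDerivAt_expSum)

/-! ## The short restricted kernel vector is impossible -/

/-- **THE SHORT RESTRICTED KERNEL VECTOR IS IMPOSSIBLE** (endgame of the mixed no-balance theorem; #55 `false_of_short_kernelVector` with
rank-zero NODES `J₀ ⊆ J` where the pencil vanishes).  Honest encoding of `J`, `9 ≤ |J|`, `μ ≥ 0`, a test matrix `X` killing the pencil at two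
non-node touches `τ_l < τ_k`, and the vector `a_j = μ_j κ_j polar(X, P(τ_j))`, supported on non-node touches before `τ_l`, not zero, and
RESTRICTED-orthogonal: `Σ_j a_j φ(τ_j) = 0` for every six-term sum `φ` vanishing at the node abscissae.  Contradiction: the node-twisted sign word
of `a` is cut by (≤ 2 flip midpoints of `κ`) Δ (≤ 3 − |J₀| flip points of `g·∏(τ_i − ·)`, `g = polar(X, P(·))` — a further flip would, by the flip
witnesses and Descartes-with-double-zeros, give `g` too many zeros), so pairing with the sign-word function vanishing at the `≤ 5` points
(cuts ∪ nodes) kills `a`. [this work] -/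
theorem false_of_short_restricted (δ : Fin 6 → ℝ) (hd : StrictMono δ) (S : Fin 6 → Matrix (Fin 2) (Fin 2) ℝ)
    (τ : Fin 21 → ℝ) (hτ : StrictMono τ) (κ : Fin 21 → ℝ) (halt : ∀ j : Fin 20, κ j.castSucc * κ j.succ < 0)
    (J J₀ : Finset (Fin 21)) (hJ₀ : J₀ ⊆ J) (h0 : (0 : Fin 21) ∉ J) (h20 : Fin.last 20 ∉ J)
    (hsep : ∀ j : Fin 20, j.castSucc ∈ J → j.succ ∉ J) (hJ9 : 9 ≤ J.card)
    (hnode : ∀ i ∈ J₀, (∑ l', Real.exp (δ l' * τ i) • S l') = 0)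
    (μ : Fin 21 → ℝ) (hμ0 : ∀ j, 0 ≤ μ j) (X : Matrix (Fin 2) (Fin 2) ℝ) (l k : Fin 21) (hlk : l < k)
    (hlN : l ∉ J₀) (hkN : k ∉ J₀)
    (hXl : polar X (∑ l', Real.exp (δ l' * τ l) • S l') = 0) (hXk : polar X (∑ l', Real.exp (δ l' * τ k) • S l') = 0)
    (hpair : ∀ c : Fin 6 → ℝ, (∀ i ∈ J₀, ∑ l', c l' * Real.exp (δ l' * τ i) = 0) →
      ∑ j, (μ j * κ j * polar X (∑ l', Real.exp (δ l' * τ j) • S l')) * (∑ l', c l' * Real.exp (δ l' * τ j)) = 0)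
    (hAJ : ∀ j, μ j * κ j * polar X (∑ l', Real.exp (δ l' * τ j) • S l') ≠ 0 → j ∈ J ∧ j ∉ J₀ ∧ j < l)
    (hne : ∃ j, μ j * κ j * polar X (∑ l', Real.exp (δ l' * τ j) • S l') ≠ 0) : False := by
  classical
  set P : Fin 21 → Matrix (Fin 2) (Fin 2) ℝ := fun j => ∑ l', Real.exp (δ l' * τ j) • S l' with hP
  set a : Fin 21 → ℝ := fun j => μ j * κ j * polar X (P j) with haDef
  -- `g` as an exponential sum with coefficient vector `cX`
  set cX : Fin 6 → ℝ := fun l' => polar X (S l') with hcX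
  set g : ℝ → ℝ := expSum cX δ with hg
  have hgP : ∀ j, polar X (P j) = g (τ j) := fun j => by
    rw [polar_expPencil]; simp only [hg, expSum, hcX]
  have hgt : ∀ t, polar X (∑ l', Real.exp (δ l' * t) • S l') = g t := fun t => by
    rw [polar_expPencil]; simp only [hg, expSum, hcX]
  have hgc : Continuous g := continuous_expSum cX δ
  have hκ : ∀ j, κ j ≠ 0 := by
    intro j hz
    rcases Fin.eq_castSucc_or_eq_last j with ⟨m, hm⟩ | hlast
    · have := halt m; rw [← hm, hz, zero_mul] at this; exact lt_irrefl _ this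
    · have := halt (Fin.last 19); rw [Fin.succ_last, ← hlast, hz, mul_zero] at this; exact lt_irrefl _ this
  -- node abscissae and the zeros of `g` there
  set Nτ : Finset ℝ := J₀.image τ with hNτ
  have hgN : ∀ n ∈ Nτ, g n = 0 := by
    intro n hn
    obtain ⟨i, hi, rfl⟩ := Finset.mem_image.1 hn
    rw [← hgt, hnode i hi, polar_zero_right]
  -- the support
  set B : Finset (Fin 21) := Finset.univ.filter fun j => a j ≠ 0 with hB
  have hBne : B.Nonempty := by obtain ⟨j, hj⟩ := hne; exact ⟨j, Finset.mem_filter.2 ⟨Finset.mem_univ _, hj⟩⟩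
  have hmemB : ∀ j, j ∈ B ↔ a j ≠ 0 := fun j => by simp [hB]
  have hBJ : ∀ j ∈ B, j ∈ J ∧ j ∉ J₀ ∧ j < l := fun j hj => hAJ j ((hmemB j).1 hj)
  have hgB : ∀ j ∈ B, g (τ j) ≠ 0 := by
    intro j hj hz; exact (hmemB j).1 hj (by show μ j * κ j * polar X (P j) = 0; rw [hgP, hz, mul_zero])
  have hμB : ∀ j ∈ B, 0 < μ j := by
    intro j hj
    refine lt_of_le_of_ne (hμ0 j) fun hz => (hmemB j).1 hj ?_
    show μ j * κ j * polar X (P j) = 0; rw [← hz]; ring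
  -- twisted values on `B`
  have htwist : ∀ j ∈ B, g (τ j) * ∏ n ∈ Nτ, (n - τ j) ≠ 0 := by
    intro j hj
    refine mul_ne_zero (hgB j hj) (Finset.prod_ne_zero_iff.2 fun n hn => sub_ne_zero.2 ?_)
    obtain ⟨i, hi, rfl⟩ := Finset.mem_image.1 hn
    exact fun h => (hBJ j hj).2.1 (by rwa [← hτ.injective h])
  obtain ⟨kB, hkB⟩ : ∃ kB, B.card = kB + 1 := ⟨B.card - 1, by have := hBne.card_pos; omega⟩
  obtain ⟨kJ, hkJ⟩ : ∃ kJ, J.card = kJ + 1 := ⟨J.card - 1, by omega⟩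
  -- SIGN CUT 1: κ along J
  obtain ⟨hW₁card, hW₁avoid, hW₁cut⟩ := signCut τ hτ J hkJ κ (fun j _ => hκ j)
  set W₁ := (Finset.univ.filter fun i : Fin kJ =>
      κ (J.orderEmbOfFin hkJ i.castSucc) * κ (J.orderEmbOfFin hkJ i.succ) < 0).image
      (fun i : Fin kJ => (τ (J.orderEmbOfFin hkJ i.castSucc) + τ (J.orderEmbOfFin hkJ i.succ)) / 2) with hW₁
  have hW₁le : W₁.card ≤ 2 := by
    rw [hW₁card]; have := card_kappaFlips_le J hkJ κ halt h0 h20 hsep; omega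
  -- `W₁` avoids the node abscissae
  have hW₁N : ∀ x ∈ W₁, x ∉ Nτ := by
    intro x hx hxN
    obtain ⟨i, hi, rfl⟩ := Finset.mem_image.1 hxN
    exact hW₁avoid i (hJ₀ hi) _ hx rfl
  -- SIGN CUT 2: the twisted `g` along `B`, at the abscissa right after each element of `B`
  set eB := B.orderEmbOfFin hkB with heB
  have hnextlt : ∀ i : Fin kB, ((eB i.castSucc : Fin 21) : ℕ) + 1 < 21 := by
    intro i
    have : eB i.castSucc < eB i.succ := eB.strictMono Fin.castSucc_lt_succ
    have h2 := (eB i.succ).2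
    exact lt_of_le_of_lt (Nat.succ_le_of_lt this) h2
  set pB : Fin kB → ℝ := fun i => τ ⟨((eB i.castSucc : Fin 21) : ℕ) + 1, hnextlt i⟩ with hpB
  have hnextJ : ∀ i : Fin kB, (⟨((eB i.castSucc : Fin 21) : ℕ) + 1, hnextlt i⟩ : Fin 21) ∉ J := by
    intro i
    have hmem : eB i.castSucc ∈ J := (hBJ _ (B.orderEmbOfFin_mem hkB _)).1
    have hlt20 : ((eB i.castSucc : Fin 21) : ℕ) < 20 := by have := hnextlt i; omega
    have := hsep ⟨(eB i.castSucc : Fin 21), hlt20⟩ (by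
      have : (⟨((eB i.castSucc : Fin 21) : ℕ), hlt20⟩ : Fin 20).castSucc = eB i.castSucc := Fin.ext rfl
      rw [this]; exact hmem)
    have heq : (⟨((eB i.castSucc : Fin 21) : ℕ), hlt20⟩ : Fin 20).succ = ⟨((eB i.castSucc : Fin 21) : ℕ) + 1, hnextlt i⟩ :=
      Fin.ext (by simp)
    rwa [heq] at this
  have hpBgap : ∀ i, τ (eB i.castSucc) < pB i ∧ pB i < τ (eB i.succ) := by
    intro i
    have hlt : eB i.castSucc < eB i.succ := eB.strictMono Fin.castSucc_lt_succ
    refine ⟨hτ (Fin.lt_def.2 (by simp)), hτ (Fin.lt_def.2 ?_)⟩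
    have hne : ((eB i.castSucc : Fin 21) : ℕ) + 1 ≠ ((eB i.succ : Fin 21) : ℕ) := by
      intro h
      apply hnextJ i
      have : (⟨((eB i.castSucc : Fin 21) : ℕ) + 1, hnextlt i⟩ : Fin 21) = eB i.succ := Fin.ext h
      rw [this]; exact (hBJ _ (B.orderEmbOfFin_mem hkB _)).1
    have := Fin.lt_def.1 hlt
    simp only; omega
  have hpBN : ∀ i, pB i ∉ Nτ := by
    intro i hn
    obtain ⟨i', hi', h⟩ := Finset.mem_image.1 hn
    have := hτ.injective h
    exact hnextJ i (by rw [← this]; exact hJ₀ hi')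
  set fB : Fin 21 → ℝ := fun j => g (τ j) * ∏ n ∈ Nτ, (n - τ j) with hfB
  obtain ⟨hW₂card, hW₂avoid, hW₂cut⟩ := signCutAt τ hτ B hkB fB htwist pB hpBgap
  set F₂ := Finset.univ.filter fun i : Fin kB => fB (eB i.castSucc) * fB (eB i.succ) < 0 with hF₂
  set W₂ := F₂.image pB with hW₂
  have hW₂N : ∀ x ∈ W₂, x ∉ Nτ := by
    intro x hx; obtain ⟨i, -, rfl⟩ := Finset.mem_image.1 hx; exact hpBN i
  -- at most `3 − |J₀|` twisted flips: each flip gap carries a non-node zero of `g` or a node where `g′ = 0`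
  have hτN : ∀ j, j ∉ J₀ → τ j ∉ Nτ := fun j hj h => by
    obtain ⟨i, hi, h⟩ := Finset.mem_image.1 h
    exact hj (by rwa [← hτ.injective h])
  have hF₂le : F₂.card + J₀.card ≤ 3 := by
    -- witnesses
    have hwit : ∀ i ∈ F₂, ∃ w, τ (eB i.castSucc) < w ∧ w < τ (eB i.succ) ∧ g w = 0 ∧
        (w ∉ Nτ ∨ expSum (fun l' => cX l' * δ l') δ w = 0) := by
      intro i hi
      have hflip := (Finset.mem_filter.1 hi).2
      exact exists_flipWitness cX δ Nτ hgN _ _ (hτ (eB.strictMono Fin.castSucc_lt_succ))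
        (hgB _ (B.orderEmbOfFin_mem hkB _)) (hgB _ (B.orderEmbOfFin_mem hkB _)) hflip
    choose! w hw1 hw2 hw3 hw4 using hwit
    have hwinj : Set.InjOn w F₂ := by
      intro i hi i' hi' h
      by_contra hne
      rcases lt_or_gt_of_ne hne with hlt | hlt
      · have : τ (eB i.succ) ≤ τ (eB i'.castSucc) := hτ.monotone (eB.monotone (by
          rw [Fin.le_def, Fin.val_succ, Fin.val_castSucc]; exact hlt))
        have := hw2 i hi; have := hw1 i' hi'; rw [h] at *; linarith
      · have : τ (eB i'.succ) ≤ τ (eB i.castSucc) := hτ.monotone (eB.monotone (by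
          rw [Fin.le_def, Fin.val_succ, Fin.val_castSucc]; exact hlt))
        have := hw2 i' hi'; have := hw1 i hi; rw [h] at *; linarith
    -- all witnesses lie below `τ l`
    have hwlt : ∀ i ∈ F₂, w i < τ l := fun i hi =>
      (hw2 i hi).trans_le ((hτ (hBJ _ (B.orderEmbOfFin_mem hkB _)).2.2).le)
    set Wit : Finset ℝ := F₂.image w with hWit
    set Z : Finset ℝ := insert (τ k) (insert (τ l) (Nτ ∪ Wit)) with hZ
    set Zd : Finset ℝ := Wit.filter fun y => y ∈ Nτ with hZd
    have hcX0 : cX ≠ 0 := by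
      intro h0
      obtain ⟨j, hj⟩ := hBne
      exact hgB j hj (by simp [hg, expSum, h0])
    have hZz : ∀ z ∈ Z, ∑ l', cX l' * Real.exp (δ l' * z) = 0 := by
      intro z hz
      change g z = 0 at *
      rcases Finset.mem_insert.1 hz with rfl | hz
      · rw [← hgt]; exact hXk
      rcases Finset.mem_insert.1 hz with rfl | hz
      · rw [← hgt]; exact hXl
      rcases Finset.mem_union.1 hz with hz | hz
      · exact hgN z hz
      · obtain ⟨i, hi, rfl⟩ := Finset.mem_image.1 hz; exact hw3 i hi
    have hZdZ : Zd ⊆ Z := fun y hy => by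
      have := (Finset.mem_filter.1 hy).1
      rw [hZ]; exact Finset.mem_insert_of_mem (Finset.mem_insert_of_mem (Finset.mem_union_right _ this))
    have hZd' : ∀ z ∈ Zd, ∑ l', cX l' * δ l' * Real.exp (δ l' * z) = 0 := by
      intro z hz
      obtain ⟨hzW, hzN⟩ := Finset.mem_filter.1 hz
      obtain ⟨i, hi, rfl⟩ := Finset.mem_image.1 hzW
      rcases hw4 i hi with h | h
      · exact absurd hzN h
      · simpa [expSum] using h
    have hcount := card_zeros_add_card_double_le δ hd cX hcX0 Z hZz Zd hZdZ hZd'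
    -- count `Z`: `τ k`, `τ l`, then `Nτ ∪ Wit`; the double witnesses are `Wit ∩ Nτ`
    have hlNW : τ l ∉ Nτ ∪ Wit := by
      intro h
      rcases Finset.mem_union.1 h with h | h
      · exact hτN l hlN h
      · obtain ⟨i, hi, h⟩ := Finset.mem_image.1 h
        have := hwlt i hi; rw [h] at this; exact lt_irrefl _ this
    have hkZ : τ k ∉ insert (τ l) (Nτ ∪ Wit) := by
      intro h
      rcases Finset.mem_insert.1 h with h | h
      · exact absurd (hτ.injective h) (ne_of_gt hlk)
      rcases Finset.mem_union.1 h with h | h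
      · exact hτN k hkN h
      · obtain ⟨i, hi, h⟩ := Finset.mem_image.1 h
        have := (hwlt i hi).trans (hτ hlk); rw [h] at this; exact lt_irrefl _ this
    have hZcard : Z.card + Zd.card = 2 + J₀.card + F₂.card := by
      rw [hZ, Finset.card_insert_of_notMem hkZ, Finset.card_insert_of_notMem hlNW, hZd, Finset.filter_mem_eq_inter,
        Finset.inter_comm]
      have h1 := Finset.card_union_add_card_inter Nτ Wit
      have hN : Nτ.card = J₀.card := Finset.card_image_of_injective _ hτ.injective
      have hW : Wit.card = F₂.card := Finset.card_image_of_injOn hwinj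
      omega
    omega
  have hW₂le : W₂.card + J₀.card ≤ 3 := by rw [hW₂, hW₂card]; exact hF₂le
  -- the change points: (W₁ Δ W₂) ∪ nodes
  set D : Finset ℝ := (W₁ \ W₂) ∪ (W₂ \ W₁) with hD
  have hDN : Disjoint D Nτ := by
    rw [Finset.disjoint_left]; intro x hx
    rcases Finset.mem_union.1 hx with hx | hx
    · exact hW₁N x (Finset.mem_sdiff.1 hx).1
    · exact hW₂N x (Finset.mem_sdiff.1 hx).1
  set U : Finset ℝ := D ∪ Nτ with hU
  have hUcard : U.card ≤ 5 := by
    have h1 : D.card ≤ W₁.card + W₂.card :=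
      (Finset.card_union_le _ _).trans (Nat.add_le_add (Finset.card_le_card Finset.sdiff_subset)
        (Finset.card_le_card Finset.sdiff_subset))
    have h2 : U.card ≤ D.card + Nτ.card := Finset.card_union_le _ _
    have h3 : Nτ.card ≤ J₀.card := Finset.card_image_le
    omega
  set q := U.card with hq
  have hq6 : q < 6 := by omega
  let u : Fin q ↪o ℝ := U.orderEmbOfFin rfl
  -- constants of the two cuts
  set c₁ := κ (J.orderEmbOfFin hkJ 0) with hc₁
  set c₂ := fB (eB 0) with hc₂
  have h1 : c₁ ≠ 0 := hκ _
  have h2 : c₂ ≠ 0 := htwist _ (B.orderEmbOfFin_mem hkB 0)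
  clear_value c₁ c₂
  have hzero := eq_zero_of_pairing_signWord δ hd hq6 u u.strictMono τ B (fun j => c₁ * c₂ * a j)
    (fun j hj => by rw [show a j = 0 from not_not.1 (fun h => hj ((hmemB j).2 h))]; ring) ?_ ?_
  · obtain ⟨j, hj⟩ := hBne
    have h3 : a j ≠ 0 := (hmemB j).1 hj
    rcases mul_eq_zero.1 (hzero j) with h | h
    · rcases mul_eq_zero.1 h with h' | h'
      · exact h1 h'
      · exact h2 h'
    · exact h3 h
  · -- sign condition on `B`
    intro j hj
    obtain ⟨hjJ, hjN, -⟩ := hBJ j hj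
    have hmemU : ∀ x ∈ U, x ≠ τ j := by
      intro x hx
      rcases Finset.mem_union.1 hx with hx | hx
      · rcases Finset.mem_union.1 hx with hx | hx
        · exact hW₁avoid j hjJ _ (Finset.mem_sdiff.1 hx).1
        · exact hW₂avoid j hj _ (Finset.mem_sdiff.1 hx).1
      · exact fun h => hτN j hjN (h ▸ hx)
    refine ⟨fun i => (hmemU _ (U.orderEmbOfFin_mem rfl i)).symm, ?_⟩
    rw [prod_orderEmbOfFin U rfl (fun x => x - τ j), hU, Finset.prod_union hDN]
    have hX1 := hW₁cut j hjJ
    have hX2 := hW₂cut j hj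
    have hμj := hμB j hj
    have hprod := mul_pos (mul_pos hX1 hX2) hμj
    have hsplit := prod_mul_prod_eq_symmDiff W₁ W₂ (fun x => x - τ j)
    rw [← hD] at hsplit
    have hre : c₁ * κ j * (∏ x ∈ W₁, (x - τ j)) * (c₂ * fB j * ∏ x ∈ W₂, (x - τ j)) * μ j =
        (c₁ * c₂ * (μ j * κ j * g (τ j)) * ((∏ x ∈ D, (x - τ j)) * ∏ n ∈ Nτ, (n - τ j))) *
          (∏ x ∈ W₁ ∩ W₂, (x - τ j)) ^ 2 := by
      simp only [hfB]
      linear_combination (c₁ * κ j * c₂ * g (τ j) * (∏ n ∈ Nτ, (n - τ j)) * μ j) * hsplit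
    rw [hre] at hprod
    have hsq : 0 < (∏ x ∈ W₁ ∩ W₂, (x - τ j)) ^ 2 := by
      have : (∏ x ∈ W₁ ∩ W₂, (x - τ j)) ≠ 0 := Finset.prod_ne_zero_iff.2 fun x hx =>
        sub_ne_zero.2 (hW₁avoid j hjJ x (Finset.mem_inter.1 hx).1)
      positivity
    have := pos_of_mul_pos_left hprod hsq.le
    have haj : a j = μ j * κ j * g (τ j) := by show μ j * κ j * polar X (P j) = _; rw [hgP]
    show 0 ≤ c₁ * c₂ * a j * ((∏ x ∈ D, (x - τ j)) * ∏ n ∈ Nτ, (n - τ j))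
    rw [haj]; exact this.le
  · -- restricted pairing: the sign-word function vanishes at the nodes (which are change points)
    intro c hc
    have hnodes : ∀ i ∈ J₀, ∑ l', c l' * Real.exp (δ l' * τ i) = 0 := by
      intro i hi
      have hmem : τ i ∈ U := Finset.mem_union_right _ (Finset.mem_image_of_mem τ hi)
      obtain ⟨m, hm⟩ : ∃ m, u m = τ i := by
        have : τ i ∈ Set.range u := by rw [Finset.range_orderEmbOfFin]; exact hmem
        exact this
      rw [← hm]; exact hc m
    have := hpair c hnodes
    calc ∑ j, c₁ * c₂ * a j * (∑ l', c l' * Real.exp (δ l' * τ j))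
        = (c₁ * c₂) * ∑ j, a j * (∑ l', c l' * Real.exp (δ l' * τ j)) := by
          rw [Finset.mul_sum Finset.univ (fun j => a j * (∑ l', c l' * Real.exp (δ l' * τ j))) (c₁ * c₂)]
          exact Finset.sum_congr rfl fun j _ => by ring
      _ = 0 := by rw [show (∑ j, a j * (∑ l', c l' * Real.exp (δ l' * τ j))) = 0 from this, mul_zero]

end Summit.ValiantsHypothesis.ValiantsHypothesis.Theorems.LacunarySymmetroidMatrixDescartes.WallBubbling
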